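import Literature.AlgebraicGeometry.Motives.TateClassesGaloisActionFiniteQuotient
import HarnessLib

/-!
# The `Γ_k`-module of Tate classes over a finite field is semisimple:
# `𝒯ᵖ(X) = H^{2p}(X)(p)^Γ ⊕ (φ_p − 1)𝒯ᵖ(X)`, every `Γ_k`-stable subspace of `𝒯ᵖ(X)` has a
# `Γ_k`-stable complement, and the image of `Γ_k` in `GL(𝒯ᵖ(X))` is the finite cyclic group `⟨φ_p⟩`

Topic `Literature/AlgebraicGeometry/Motives`; THEOREMS ONLY (no definition, no instance, no named
fact; D-0026).

J. Tate, *Conjectures on algebraic cycles in ℓ-adic cohomology* (1994) §1 states, next to `T^p`, the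
semisimplicity conjecture `S` («the Galois representation `Hⁱ(X)` is semisimple», the tree's
`GaloisWeilCohomology.TateSemisimplicityFor`), and J. S. Milne (*The Tate conjecture over finite
fields*, arXiv:0709.3040 §1, held, p. 3) its finite-field form «Conjecture `S^r(X, ℓ)` (Partial
semisimplicity). Every Frobenius map `π` of `X` acts semisimply on `H^{2r}(X, ℚ_ℓ(r))₁` (i.e., it acts
as `1`)»; B. Kahn (*Zeta and L-functions of varieties and motives* (2020) §6.14, held, p. 132) writes
`S^i(X, l)` as «`H^{2i}_l(X)(i)^G ↪ H^{2i}_l(X)(i) → H^{2i}_l(X)(i)_G` is bijective», i.e.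
`H = H^G ⊕ 𝔞H`.  ON THE TATE CLASSES `𝒯ᵖ(X)` (Tate's classes fixed by an open subgroup; the tree's
`tateClasses = smoothInvariants`) all of this HOLDS UNCONDITIONALLY for the tree's abstract
`E : GaloisWeilCohomology k K χ` over a finite field `k` (no continuity of `ρ`), because `Γ_k` acts on
`𝒯ᵖ(X)` through the finite cyclic group generated by the twisted Frobenius `φ_p` (row g39-#1
`TateClassesGaloisActionFiniteQuotient`) and `K` has characteristic `0` (Maschke for a cyclic group):

* §1 for `W ≤ 𝒯ᵖ(X)`, «`Γ_k`-stable» ⟺ «`φ_p`-stable» (`forall_ρTwist_apply_mem_iff_of_le_tateClasses`);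
  **every `Γ_k`-stable `W ≤ 𝒯ᵖ(X)` has a `Γ_k`-stable complement in `𝒯ᵖ(X)`**
  (`exists_galois_stable_compl_of_le_tateClasses`, from the semisimplicity of `φ_p|𝒯` via Mathlib's
  `Module.End.isSemisimple_restrict_iff`);
* §2 the same in Mathlib's typed language: **the subrepresentation of `H^{2p}(X)(p)` on `𝒯ᵖ(X)` is a
  semisimple representation of `Γ_k`** (`isSemisimpleRepresentation_tateClasses`:
  `Representation.IsSemisimpleRepresentation`, Tate's `S` ON the Tate classes);
* §3 **the image of `Γ_k` in `End(𝒯ᵖ(X))` is finite**: `φ_p|𝒯` has finite order `N` and every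
  `χ(g)ᵖρ(g)|𝒯` is `φ_p|𝒯 ^ r`, `r < N` (`exists_forall_restrict_ρTwist_eq_pow`,
  `finite_range_restrict_ρTwist_tateClasses`);
* §4 the UNTWISTED geometric Frobenius on Tate classes: `ρ(F)^N = χ(F)^{−pN}` on `𝒯ᵖ(X)`
  (`exists_forall_ρ_geomFrob_pow_apply_eq_smul`) — its eigenvalues there are `χ(F)^{−p}` times roots
  of unity (`pow_eq_one_of_ρ_apply_eq_smul_of_mem_tateClasses`; for `ℓ`-adic cohomology `χ(F) = q⁻¹`,
  eigenvalues `q^p ζ`);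
* §5 KAHN'S DECOMPOSITION ON THE TATE CLASSES: **`𝒯ᵖ(X) = H^{2p}(X)(p)^Γ ⊕ (φ_p − 1)𝒯ᵖ(X)`**
  (`invariants_inf_map_sub_one_tateClasses_eq_bot`, `invariants_sup_map_sub_one_tateClasses_eq`,
  `isCompl_invariants_map_sub_one_tateClasses`, `finrank_tateClasses_eq_finrank_invariants_add`), and
  under `T^p(X)`: `𝒯ᵖ(X) = K·Aᵖ(X) ⊕ (φ_p − 1)𝒯ᵖ(X)`;
* §6 `𝒯ᵖ(X) = H^Γ ⟺ φ_p = 1` on `𝒯ᵖ(X)` (`tateClasses_eq_invariants_iff`), and «all Tate classes are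
  algebraic over `k`» ⟺ `T^p(X) ∧ 𝒯ᵖ(X) = H^Γ` (`tateClasses_le_algebraicClasses_iff`).

What this file does NOT do: Tate's `S^{2p}(X)` for ALL of `H^{2p}(X)(p)` is not proved (it needs the
classes outside `𝒯ᵖ(X)`), nor `T^p`.  HC is not touched.

## Provenance

Lane `lit-hodgefound` (summit `HodgeConjecture`, Track 2 foundations library, Layer B: motives),
seat `lit-hodgefound-p29` (literature-prover, generation 39, row g39-#2).
-/

universe u v

open CategoryTheory AlgebraicGeometry

noncomputable section

namespace Literature.AlgebraicGeometry.Motives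

namespace GaloisWeilCohomology

variable {k : Type u} [Field k] [Finite k] {K : Type v} [Field K] [CharZero K]
  {χ : Field.absoluteGaloisGroup k →* Kˣ} (E : GaloisWeilCohomology k K χ)
variable {d : ℕ} {X : SchemeOver k}

/-! ## §1 `Γ_k`-stable subspaces of `𝒯ᵖ(X)` and their complements -/

/-- For a subspace `W` of the Tate classes, **`Γ_k`-stable ⟺ `φ_p`-stable** (`X` smooth projective
over a finite field): every `χ(g)ᵖρ(g)` is a power of `φ_p` on `𝒯ᵖ(X)`.
[cite: Milne2007TateFiniteFieldsAIM, §1] [cite: Tate1994, §1] -/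
theorem forall_ρTwist_apply_mem_iff_of_le_tateClasses (hX : IsSmoothProjective d X) (p : ℕ)
    {W : Submodule K (E.obj X (2 * p))} (hW : W ≤ E.tateClasses X p) :
    (∀ g : Field.absoluteGaloisGroup k, ∀ x ∈ W, E.ρTwist X (2 * p) p g x ∈ W) ↔
      ∀ x ∈ W, E.ρTwist X (2 * p) p (geomFrob k) x ∈ W := by
  refine ⟨fun h ↦ h _, fun h g x hx ↦ ?_⟩
  obtain ⟨N, -, -, hN⟩ := E.exists_forall_ρTwist_apply_eq_pow_apply hX p
  obtain ⟨r, -, hr⟩ := hN g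
  rw [hr x (hW hx), Module.End.pow_apply]
  exact Set.MapsTo.iterate (s := (W : Set (E.obj X (2 * p)))) h r hx

/-- **Every `φ_p`-stable subspace of `𝒯ᵖ(X)` has a `φ_p`-stable complement inside `𝒯ᵖ(X)`** (`X`
smooth projective over a finite field, char `K` = 0): `φ_p|𝒯ᵖ(X)` is semisimple (row g39-#1).
[cite: Milne2007TateFiniteFieldsAIM, §1 Conjecture S^r(X, ℓ)] [cite: Tate1994, §1] -/
theorem exists_frob_stable_compl_of_le_tateClasses (hX : IsSmoothProjective d X) (p : ℕ)
    {W : Submodule K (E.obj X (2 * p))} (hW : W ≤ E.tateClasses X p)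
    (hφ : ∀ x ∈ W, E.ρTwist X (2 * p) p (geomFrob k) x ∈ W) :
    ∃ W' ≤ E.tateClasses X p, (∀ x ∈ W', E.ρTwist X (2 * p) p (geomFrob k) x ∈ W') ∧
      Disjoint W W' ∧ W ⊔ W' = E.tateClasses X p :=
  (Module.End.isSemisimple_restrict_iff (E.tateClasses X p) _).mp
    (E.isSemisimple_restrict_frob_tateClasses hX p) W hφ hW

/-- **Every `Γ_k`-stable subspace of `𝒯ᵖ(X)` has a `Γ_k`-stable complement inside `𝒯ᵖ(X)`**: the
`Γ_k`-module of Tate classes is completely reducible (`X` smooth projective over a finite field,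
char `K` = 0, NO continuity of `ρ`) — Tate's semisimplicity conjecture holds on the Tate classes.
[cite: Tate1994, §1] [cite: Milne2007TateFiniteFieldsAIM, §1 Conjecture S^r(X, ℓ)] -/
theorem exists_galois_stable_compl_of_le_tateClasses (hX : IsSmoothProjective d X) (p : ℕ)
    {W : Submodule K (E.obj X (2 * p))} (hW : W ≤ E.tateClasses X p)
    (hΓ : ∀ g : Field.absoluteGaloisGroup k, ∀ x ∈ W, E.ρTwist X (2 * p) p g x ∈ W) :
    ∃ W' ≤ E.tateClasses X p,
      (∀ g : Field.absoluteGaloisGroup k, ∀ x ∈ W', E.ρTwist X (2 * p) p g x ∈ W') ∧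
      Disjoint W W' ∧ W ⊔ W' = E.tateClasses X p := by
  obtain ⟨W', hW', hφ', hd, hsup⟩ := E.exists_frob_stable_compl_of_le_tateClasses hX p hW (hΓ _)
  exact ⟨W', hW', (E.forall_ρTwist_apply_mem_iff_of_le_tateClasses hX p hW').mpr hφ', hd, hsup⟩

/-! ## §2 The subrepresentation `𝒯ᵖ(X)` is semisimple -/

/-- **The representation of `Γ_k` on the Tate classes `𝒯ᵖ(X) ⊆ H^{2p}(X)(p)` is SEMISIMPLE**
(Mathlib `Representation.IsSemisimpleRepresentation` of the subrepresentation; `X` smooth projective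
over a finite field, char `K` = 0, no continuity): its subrepresentations are the `φ_p|𝒯`-stable
subspaces, and `φ_p|𝒯` is a semisimple endomorphism.  Tate's `S` ON the Tate classes.
[cite: Tate1994, §1] [cite: Milne2007TateFiniteFieldsAIM, §1 Conjecture S^r(X, ℓ)] -/
theorem isSemisimpleRepresentation_tateClasses (hX : IsSmoothProjective d X) (p : ℕ) :
    (Subrepresentation.toRepresentation
        (⟨E.tateClasses X p, fun g _ hx ↦ E.ρTwist_apply_mem_tateClasses X p g hx⟩ :
          Subrepresentation (E.ρTwist X (2 * p) p))).IsSemisimpleRepresentation := by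
  set T : Subrepresentation (E.ρTwist X (2 * p) p) :=
    ⟨E.tateClasses X p, fun g _ hx ↦ E.ρTwist_apply_mem_tateClasses X p g hx⟩ with hT
  -- the Frobenius of the subrepresentation is `φ_p|𝒯`, a semisimple endomorphism
  have hss : Module.End.IsSemisimple (T.toRepresentation (geomFrob k)) :=
    E.isSemisimple_restrict_frob_tateClasses hX p
  obtain ⟨N, -, -, hN⟩ := E.exists_forall_ρTwist_apply_eq_pow_apply hX p
  -- every `g` acts on `𝒯` as a power of the Frobenius
  have hpow : ∀ g : Field.absoluteGaloisGroup k, ∃ r : ℕ,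
      T.toRepresentation g = T.toRepresentation (geomFrob k) ^ r := fun g ↦ by
    obtain ⟨r, -, hr⟩ := hN g
    refine ⟨r, LinearMap.ext fun x ↦ Subtype.ext ?_⟩
    rw [← map_pow]
    change E.ρTwist X (2 * p) p g x = E.ρTwist X (2 * p) p (geomFrob k ^ r) x
    rw [map_pow, hr x x.2]
  refine ⟨fun W ↦ ?_⟩
  obtain ⟨Q, hQ, hWQ⟩ := Module.End.isSemisimple_iff.mp hss W.toSubmodule
    (fun x hx ↦ W.apply_mem_toSubmodule (geomFrob k) hx)
  have hQg : ∀ g : Field.absoluteGaloisGroup k, ∀ x ∈ Q, T.toRepresentation g x ∈ Q :=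
    fun g x hx ↦ by
    obtain ⟨r, hr⟩ := hpow g
    rw [hr, Module.End.pow_apply]
    exact Set.MapsTo.iterate (s := (Q : Set (E.tateClasses X p))) hQ r hx
  refine ⟨⟨Q, fun g _ hx ↦ hQg g _ hx⟩,
    isCompl_iff.mpr ⟨disjoint_iff.mpr ?_, codisjoint_iff.mpr ?_⟩⟩
  · apply Subrepresentation.toSubmodule_injective
    change W.toSubmodule ⊓ Q = ⊥
    exact hWQ.inf_eq_bot
  · apply Subrepresentation.toSubmodule_injective
    change W.toSubmodule ⊔ Q = ⊤
    exact hWQ.sup_eq_top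

/-! ## §3 The image of `Γ_k` in `End(𝒯ᵖ(X))` is the finite cyclic group generated by `φ_p|𝒯` -/

/-- **`φ_p|𝒯ᵖ(X)` has finite order and every `χ(g)ᵖρ(g)|𝒯ᵖ(X)` is a power of it**: one `N ≥ 1`
with `(φ_p|𝒯)^N = 1` and `ρ(g)|𝒯 = (φ_p|𝒯)^r`, `r < N` (`X` smooth projective over a finite field;
Milne: «`π₁^{n₂N} = π₂^{n₁N}`», all Frobenius maps generate commensurable cyclic groups).
[cite: Milne2007TateFiniteFieldsAIM, §1] [cite: Tate1994, §1] -/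
theorem exists_forall_restrict_ρTwist_eq_pow (hX : IsSmoothProjective d X) (p : ℕ) :
    ∃ N : ℕ, 0 < N ∧
      (E.ρTwist X (2 * p) p (geomFrob k)).restrict
          (fun _ hx ↦ E.ρTwist_apply_mem_tateClasses X p (geomFrob k) hx) ^ N = 1 ∧
      ∀ g : Field.absoluteGaloisGroup k, ∃ r < N,
        (E.ρTwist X (2 * p) p g).restrict (fun _ hx ↦ E.ρTwist_apply_mem_tateClasses X p g hx) =
          (E.ρTwist X (2 * p) p (geomFrob k)).restrict
            (fun _ hx ↦ E.ρTwist_apply_mem_tateClasses X p (geomFrob k) hx) ^ r := by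
  obtain ⟨N, hN, hfix, hpow⟩ := E.exists_forall_ρTwist_apply_eq_pow_apply hX p
  refine ⟨N, hN, ?_, fun g ↦ ?_⟩
  · rw [Module.End.pow_restrict]
    ext ⟨x, hx⟩
    rw [LinearMap.coe_restrict_apply, Module.End.one_apply]
    exact hfix x hx
  · obtain ⟨r, hr, h⟩ := hpow g
    refine ⟨r, hr, ?_⟩
    rw [Module.End.pow_restrict]
    ext ⟨x, hx⟩
    rw [LinearMap.coe_restrict_apply, LinearMap.coe_restrict_apply]
    exact h x hx

/-- **The image of `Γ_k` in `End(𝒯ᵖ(X))` is finite** (contained in `{(φ_p|𝒯)^r : r < N}`; `X` smooth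
projective over a finite field, no continuity of `ρ`). [cite: Milne2007TateFiniteFieldsAIM, §1]
[cite: Tate1994, §1] -/
theorem finite_range_restrict_ρTwist_tateClasses (hX : IsSmoothProjective d X) (p : ℕ) :
    (Set.range fun g : Field.absoluteGaloisGroup k ↦
      (E.ρTwist X (2 * p) p g).restrict
        (fun _ hx ↦ E.ρTwist_apply_mem_tateClasses X p g hx)).Finite := by
  obtain ⟨N, -, -, hpow⟩ := E.exists_forall_restrict_ρTwist_eq_pow hX p
  refine ((Finset.range N).finite_toSet.image fun r : ℕ ↦
    (E.ρTwist X (2 * p) p (geomFrob k)).restrict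
      (fun _ hx ↦ E.ρTwist_apply_mem_tateClasses X p (geomFrob k) hx) ^ r).subset ?_
  rintro _ ⟨g, rfl⟩
  obtain ⟨r, hr, h⟩ := hpow g
  exact ⟨r, Finset.mem_coe.mpr (Finset.mem_range.mpr hr), h.symm⟩

/-! ## §4 The untwisted geometric Frobenius on the Tate classes -/

/-- The twisted Frobenius is `χ(F)ʲ` times the untwisted one, as endomorphisms of `Hⁱ(X)`.
[cite: Tate1994, §1] -/
theorem ρTwist_geomFrob_eq_smul (X : SchemeOver k) (i : ℕ) (j : ℤ) :
    E.ρTwist X i j (geomFrob k) = ((χ (geomFrob k) : K) ^ j) • E.ρ X i (geomFrob k) :=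
  LinearMap.ext fun _ ↦ rfl

/-- **`ρ(F)^N = χ(F)^{−pN}` on `𝒯ᵖ(X)`** for one `N ≥ 1`: on the Tate classes a power of the
UNTWISTED geometric Frobenius is the scalar `(χ(F)ᵖ)^{−N}` (`X` smooth projective over a finite field;
for `ℓ`-adic cohomology `χ(F) = q⁻¹`, so `F^N = q^{pN}` there). [cite: Milne2007TateFiniteFieldsAIM, §1]
[cite: Tate1994, §1] -/
theorem exists_forall_ρ_geomFrob_pow_apply_eq_smul (hX : IsSmoothProjective d X) (p : ℕ) :
    ∃ N : ℕ, 0 < N ∧ ∀ x ∈ E.tateClasses X p,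
      (E.ρ X (2 * p) (geomFrob k) ^ N) x = ((((χ (geomFrob k) : K) ^ (p : ℤ)) ^ N)⁻¹) • x := by
  obtain ⟨N, hN, hfix, -⟩ := E.exists_forall_ρTwist_apply_eq_pow_apply hX p
  refine ⟨N, hN, fun x hx ↦ ?_⟩
  have hc : (((χ (geomFrob k) : K) ^ (p : ℤ)) ^ N) ≠ 0 :=
    pow_ne_zero _ (zpow_ne_zero _ (χ (geomFrob k)).ne_zero)
  have h := hfix x hx
  rw [E.ρTwist_geomFrob_eq_smul X (2 * p) p, smul_pow, LinearMap.smul_apply] at h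
  exact (eq_inv_smul_iff₀ hc).mpr h

/-- **The eigenvalues of the untwisted geometric Frobenius on Tate classes are `χ(F)^{−p}` times
roots of unity**: one `N ≥ 1` with `(χ(F)ᵖ a)^N = 1` whenever `ρ(F) x = a x` for a non-zero Tate class
`x` (`X` smooth projective over a finite field; `ℓ`-adically: `a = q^p ζ`, `ζ^N = 1`).
[cite: Milne2007TateFiniteFieldsAIM, §1] [cite: Tate1994, §1] -/
theorem pow_eq_one_of_ρ_apply_eq_smul_of_mem_tateClasses (hX : IsSmoothProjective d X) (p : ℕ) :
    ∃ N : ℕ, 0 < N ∧ ∀ (a : K) (x : E.obj X (2 * p)), x ∈ E.tateClasses X p → x ≠ 0 →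
      E.ρ X (2 * p) (geomFrob k) x = a • x → (((χ (geomFrob k) : K) ^ (p : ℤ)) * a) ^ N = 1 := by
  obtain ⟨N, hN, h⟩ := E.pow_eq_one_of_apply_eq_smul_of_mem_tateClasses hX p
  refine ⟨N, hN, fun a x hx hx0 ha ↦ h _ x hx hx0 ?_⟩
  rw [ρTwist_apply, ha, smul_smul]

/-! ## §5 Kahn's decomposition on the Tate classes: `𝒯ᵖ(X) = H^Γ ⊕ (φ_p − 1)𝒯ᵖ(X)` -/

/-- `H^{2p}(X)(p)^Γ ∩ (φ_p − 1)𝒯ᵖ(X) = 0` (`X` smooth projective over a finite field, char `K` = 0).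
[cite: Kahn2020, §6.14 p. 132 S^i(X, l)] [cite: Milne2007TateFiniteFieldsAIM, §1 Conjecture S^r(X, ℓ)] -/
theorem invariants_inf_map_sub_one_tateClasses_eq_bot (hX : IsSmoothProjective d X) (p : ℕ) :
    (E.ρTwist X (2 * p) p).invariants ⊓
        (E.tateClasses X p).map (E.ρTwist X (2 * p) p (geomFrob k) - 1) = ⊥ :=
  le_bot_iff.mp <| (inf_le_inf_right _ (E.invariants_le_ker_sub_one p (geomFrob k))).trans
    (E.ker_sub_one_inf_map_tateClasses_eq_bot hX p).le

/-- `(φ_p − 1)𝒯ᵖ(X) ⊆ 𝒯ᵖ(X)`. [cite: Tate1994, §1] -/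
theorem map_sub_one_tateClasses_le (X : SchemeOver k) (p : ℕ) :
    (E.tateClasses X p).map (E.ρTwist X (2 * p) p (geomFrob k) - 1) ≤ E.tateClasses X p :=
  Submodule.map_le_iff_le_comap.mpr fun _ hx ↦
    Submodule.sub_mem _ (E.ρTwist_apply_mem_tateClasses X p (geomFrob k) hx) hx

/-- **`H^{2p}(X)(p)^Γ + (φ_p − 1)𝒯ᵖ(X) = 𝒯ᵖ(X)`** (`X` smooth projective over a finite field, char
`K` = 0): `φ_p|𝒯` is semisimple, so `𝒯 = Ker(φ_p|𝒯 − 1) ⊕ Im(φ_p|𝒯 − 1)`, and `Ker(φ_p|𝒯 − 1) = H^Γ`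
(row g39-#1). [cite: Kahn2020, §6.14 p. 132 S^i(X, l)] [cite: Milne2007TateFiniteFieldsAIM, §1 Conjecture S^r(X, ℓ)] -/
theorem invariants_sup_map_sub_one_tateClasses_eq (hX : IsSmoothProjective d X) (p : ℕ) :
    (E.ρTwist X (2 * p) p).invariants ⊔
        (E.tateClasses X p).map (E.ρTwist X (2 * p) p (geomFrob k) - 1) = E.tateClasses X p := by
  haveI := E.finite_obj hX (2 * p)
  set φ := E.ρTwist X (2 * p) p (geomFrob k) with hφ
  have hT : ∀ x ∈ E.tateClasses X p, φ x ∈ E.tateClasses X p := fun x hx ↦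
    E.ρTwist_apply_mem_tateClasses X p (geomFrob k) hx
  have hss : Module.End.IsSemisimple (φ.restrict hT) := E.isSemisimple_restrict_frob_tateClasses hX p
  have hc := Literature.LinearAlgebra.isCompl_ker_sub_one_range_of_isSemisimple hss
  refine le_antisymm (sup_le (E.invariants_le_tateClasses X p) (E.map_sub_one_tateClasses_le X p))
    fun x hx ↦ ?_
  have hx' : (⟨x, hx⟩ : E.tateClasses X p) ∈
      LinearMap.ker (φ.restrict hT - 1) ⊔ LinearMap.range (φ.restrict hT - 1) := by
    rw [hc.sup_eq_top]; exact Submodule.mem_top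
  obtain ⟨a, ha, b, hb, hab⟩ := Submodule.mem_sup.mp hx'
  rw [Submodule.mem_sup]
  refine ⟨(a : E.obj X (2 * p)), ?_, (b : E.obj X (2 * p)), ?_, ?_⟩
  · rw [LinearMap.mem_ker, LinearMap.sub_apply, Module.End.one_apply, sub_eq_zero, Subtype.ext_iff,
      LinearMap.coe_restrict_apply] at ha
    exact (E.mem_invariants_iff_mem_tateClasses_and_apply_eq X p _).mpr ⟨a.2, ha⟩
  · obtain ⟨c, rfl⟩ := hb
    refine Submodule.mem_map.mpr ⟨c, c.2, ?_⟩
    simp only [LinearMap.sub_apply, Module.End.one_apply, Submodule.coe_sub,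
      LinearMap.coe_restrict_apply]
  · rw [← Submodule.coe_add, hab]

/-- **`𝒯ᵖ(X) = H^{2p}(X)(p)^Γ ⊕ (φ_p − 1)𝒯ᵖ(X)`** — Kahn's `H = H^G ⊕ 𝔞H` / Milne's `S^p`, ON THE
TATE CLASSES, unconditionally for the abstract theory over a finite field (char `K` = 0): the two
pieces are complementary subspaces of `H^{2p}(X)(p)` with join `𝒯ᵖ(X)`.
[cite: Kahn2020, §6.14 p. 132 S^i(X, l)] [cite: Milne2007TateFiniteFieldsAIM, §1 Conjecture S^r(X, ℓ)] [cite: Tate1994, §1] -/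
theorem isCompl_invariants_map_sub_one_tateClasses (hX : IsSmoothProjective d X) (p : ℕ) :
    Disjoint (E.ρTwist X (2 * p) p).invariants
        ((E.tateClasses X p).map (E.ρTwist X (2 * p) p (geomFrob k) - 1)) ∧
      (E.ρTwist X (2 * p) p).invariants ⊔
          (E.tateClasses X p).map (E.ρTwist X (2 * p) p (geomFrob k) - 1) = E.tateClasses X p :=
  ⟨disjoint_iff.mpr (E.invariants_inf_map_sub_one_tateClasses_eq_bot hX p),
    E.invariants_sup_map_sub_one_tateClasses_eq hX p⟩

/-- **`dim 𝒯ᵖ(X) = dim H^{2p}(X)(p)^Γ + dim (φ_p − 1)𝒯ᵖ(X)`** (`X` smooth projective over a finite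
field, char `K` = 0). [cite: Kahn2020, §6.14 p. 132] [cite: Tate1994, §1] -/
theorem finrank_tateClasses_eq_finrank_invariants_add (hX : IsSmoothProjective d X) (p : ℕ) :
    Module.finrank K (E.tateClasses X p) =
      Module.finrank K (E.ρTwist X (2 * p) p).invariants +
        Module.finrank K ((E.tateClasses X p).map (E.ρTwist X (2 * p) p (geomFrob k) - 1)) := by
  haveI := E.finite_obj hX (2 * p)
  have h := Submodule.finrank_sup_add_finrank_inf_eq (E.ρTwist X (2 * p) p).invariants
    ((E.tateClasses X p).map (E.ρTwist X (2 * p) p (geomFrob k) - 1))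
  rw [E.invariants_inf_map_sub_one_tateClasses_eq_bot hX p, finrank_bot, add_zero,
    E.invariants_sup_map_sub_one_tateClasses_eq hX p] at h
  exact h

/-- Under `T^p(X)`: **`𝒯ᵖ(X) = K·Aᵖ(X) ⊕ (φ_p − 1)𝒯ᵖ(X)`** (`X` smooth projective over a finite field,
char `K` = 0). [cite: Tate1994, §1 Conjecture T^p] [cite: Kahn2020, §6.14 p. 132] -/
theorem algebraicClasses_sup_map_sub_one_tateClasses_eq_of_tateConjectureFor
    (hX : IsSmoothProjective d X) (p : ℕ) (hT : E.TateConjectureFor X p) :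
    Disjoint (E.algebraicClasses X p)
        ((E.tateClasses X p).map (E.ρTwist X (2 * p) p (geomFrob k) - 1)) ∧
      E.algebraicClasses X p ⊔
          (E.tateClasses X p).map (E.ρTwist X (2 * p) p (geomFrob k) - 1) = E.tateClasses X p := by
  rw [hT]
  exact E.isCompl_invariants_map_sub_one_tateClasses hX p

/-! ## §6 When are all Tate classes invariant, or algebraic over `k`? -/

/-- **`𝒯ᵖ(X) = H^{2p}(X)(p)^Γ ⟺ φ_p` fixes every Tate class** (`k` finite; no smoothness needed).
[cite: Milne2007TateFiniteFieldsAIM, §1] [cite: Tate1994, §1] -/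
theorem tateClasses_eq_invariants_iff (X : SchemeOver k) (p : ℕ) :
    E.tateClasses X p = (E.ρTwist X (2 * p) p).invariants ↔
      ∀ x ∈ E.tateClasses X p, E.ρTwist X (2 * p) p (geomFrob k) x = x := by
  constructor
  · intro h x hx
    rw [h] at hx
    exact ((E.mem_invariants_iff_mem_tateClasses_and_apply_eq X p x).mp hx).2
  · intro h
    exact le_antisymm
      (fun x hx ↦ (E.mem_invariants_iff_mem_tateClasses_and_apply_eq X p x).mpr ⟨hx, h x hx⟩)
      (E.invariants_le_tateClasses X p)

omit [Finite k] in
/-- **All Tate classes are algebraic over `k` ⟺ `T^p(X)` holds AND `𝒯ᵖ(X) = H^Γ`** (`X` smooth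
projective over any field: `K·Aᵖ ⊆ H^Γ ⊆ 𝒯ᵖ` always); then
`K·Aᵖ(X) = H^Γ = 𝒯ᵖ(X)`. [cite: Tate1994, §1 Conjecture T^p] [cite: Milne2007TateFiniteFieldsAIM, §1 Conjecture T^r(X, ℓ)] -/
theorem tateClasses_le_algebraicClasses_iff (hX : IsSmoothProjective d X) (p : ℕ) :
    E.tateClasses X p ≤ E.algebraicClasses X p ↔
      E.TateConjectureFor X p ∧ E.tateClasses X p = (E.ρTwist X (2 * p) p).invariants := by
  constructor
  · intro h
    exact ⟨le_antisymm (E.algebraicClasses_le_invariants hX p) ((E.invariants_le_tateClasses X p).trans h),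
      le_antisymm (h.trans (E.algebraicClasses_le_invariants hX p)) (E.invariants_le_tateClasses X p)⟩
  · rintro ⟨hT, h⟩
    rw [h, ← hT]

end GaloisWeilCohomology

end Literature.AlgebraicGeometry.Motives

end
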